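import Summits.RiemannHypothesis.RiemannHypothesis.Theses.LiTailLaguerre
import Summits.RiemannHypothesis.RiemannHypothesis.Theorems.LiTailLaguerreGammaTailCauchy
import HarnessLib

/-!
# RiemannHypothesis / LiTailLaguerre — crux K3′ `LiGammaTailShift`: the gamma tail IS the smooth tail, up to `O(log n)` (RH-FREE)

RH-FREE [rh-li-eng-2 g4; binder K3′ of round 7, DEALING.md «tail-p1 when minted; else any idle prover»].  Route
`Theses/LiTailLaguerre.lean` (rung «Li TAIL–LAGUERRE LAW» `LiTheory.LiZeroTailLaguerre`, L-P(P1-tail); cell `pub/rh-li`,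
dossier `theory/route/r7`), item `LiGammaTailShift` (stmt-RiemannHypothesis-19704): for every `c > 0` there are `N`, `C` with

  `|liGammaTail n T − liSmoothTail n T| ≤ C log n`   whenever `n ≥ N`, `c√n ≤ T ≤ n`.

Proof = the registered skeleton (`theory/route/r7/bc`, `LiGammaTailShift.Birth`) with both stubs PROVED:
* `stub_gamma_cauchy` = `GammaTail.abs_liGammaTail_sub_liSmoothTail_le` (part 2, `Theorems/LiTailLaguerreGammaTailCauchy.lean`):
  Cauchy on `[1/2, 3/2] × [T, Y]` for `(−½ log π + ½ ψ(w/2))(2 − k_n(w))`, `Y → ∞` (top connector `≪ n log² Y / Y → 0`); on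
  the critical line `2 − k_n(½ + it) = 2(1 − cos nθ(t))` and `Re(−½ log π + ½ ψ(¼ + it/2)) = ϑ'(t)`, so the shifted integral IS
  `liSmoothTail n T`, and `|liGammaTail n T − liSmoothTail n T| ≤ (1/π)‖gammaConnector n T‖` for `T ≥ 1`;
* `stub_gamma_connector` = `GammaTail.gammaConnector_bound` (here): `‖gammaConnector n T‖ ≤ (½ log(T + 4) + 5)(3 + e^{n/T²})`
  (part 1) `≤ 6(3 + e^{1/c²}) log n` for `n ≥ ⌈1/c²⌉ + 3`, `c√n ≤ T ≤ n` (`T ≥ 1`, `n/T² ≤ 1/c²`, `log(T + 4) ≤ 2 log n`).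
A near-copy of the PROVED `LiPrimeEchoGammaShift` (route LiPrimeEcho) on the unbounded strip, for an arbitrary `c > 0`.
An RH-free contour-shift estimate for a smooth archimedean integral; nothing about zeros; nothing here bears on the truth of RH.
-/

noncomputable section

-- D-0017: `Summit.<S>.<S>.…` is the designed namespace of a single-problem summit.
set_option linter.dupNamespace false

open Complex MeasureTheory intervalIntegral Set Filter
open scoped Real Interval Topology

namespace Summit.RiemannHypothesis.RiemannHypothesis.Theorems.LiTheory

open Literature.NumberTheory.LFunctions

namespace GammaTail

/-- **Connector bound** (the registered skeleton stub `stub_gamma_connector` of K3′): for `c > 0` there are `N`, `C` (here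
`N = ⌈1/c²⌉ + 3`, `C = 6(3 + e^{1/c²})`) with `‖gammaConnector n T‖ ≤ C log n` whenever `n ≥ N`, `c√n ≤ T ≤ n`. -/
theorem gammaConnector_bound :
    ∀ c : ℝ, 0 < c → ∃ N : ℕ, ∃ C : ℝ, ∀ n : ℕ, N ≤ n → ∀ T : ℝ, c * Real.sqrt n ≤ T → T ≤ n →
      ‖gammaConnector n T‖ ≤ C * Real.log n := by
  intro c hc
  refine ⟨⌈1 / c ^ 2⌉₊ + 3, 6 * (3 + Real.exp (1 / c ^ 2)), fun n hn T hT1 hT2 ↦ ?_⟩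
  -- sizes: `n ≥ 3`, `n ≥ 1/c²`, hence `T ≥ c√n ≥ 1`
  have hn3 : (3 : ℝ) ≤ n := by exact_mod_cast (show 3 ≤ n by omega)
  have hnc : 1 / c ^ 2 ≤ (n : ℝ) := (Nat.le_ceil _).trans (by exact_mod_cast (show ⌈1 / c ^ 2⌉₊ ≤ n by omega))
  have hs : 1 / c ≤ Real.sqrt n := by
    rw [← Real.sqrt_sq (le_of_lt (one_div_pos.mpr hc))]
    refine Real.sqrt_le_sqrt ?_
    rw [one_div_pow]; exact hnc
  have hT : 1 ≤ T := by
    have := mul_le_mul_of_nonneg_left hs hc.le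
    rw [mul_one_div_cancel hc.ne'] at this
    linarith
  have hT0 : 0 < T := by linarith
  -- `n/T² ≤ 1/c²`
  have hTsq : c ^ 2 * n ≤ T ^ 2 := by
    have h0 : 0 ≤ c * Real.sqrt n := by positivity
    have := pow_le_pow_left₀ h0 hT1 2
    rw [mul_pow, Real.sq_sqrt (by positivity)] at this
    exact this
  have hexp : Real.exp (n / T ^ 2) ≤ Real.exp (1 / c ^ 2) := by
    refine Real.exp_le_exp.2 ?_
    rw [div_le_div_iff₀ (by positivity) (by positivity), one_mul]
    linarith
  -- `1 ≤ log n`, `log(T + 4) ≤ 2 log n`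
  have hlogn1 : 1 ≤ Real.log n := by
    rw [Real.le_log_iff_exp_le (by linarith)]
    have := Real.exp_one_lt_d9; linarith
  have hlogT : Real.log (T + 4) ≤ 2 * Real.log n := by
    have h1 : T + 4 ≤ (n : ℝ) ^ 2 := by nlinarith
    calc Real.log (T + 4) ≤ Real.log ((n : ℝ) ^ 2) := Real.log_le_log (by linarith) h1
      _ = 2 * Real.log n := by rw [Real.log_pow]; push_cast; ring
  calc ‖gammaConnector n T‖ ≤ (Real.log (T + 4) / 2 + 5) * (3 + Real.exp (n / T ^ 2)) := norm_gammaConnector_le n hT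
    _ ≤ (Real.log n + 5 * Real.log n) * (3 + Real.exp (1 / c ^ 2)) :=
        mul_le_mul (by linarith) (by linarith) (by positivity) (by linarith)
    _ = 6 * (3 + Real.exp (1 / c ^ 2)) * Real.log n := by ring

end GammaTail

open GammaTail in
/-- **Crux K3′ `LiGammaTailShift` of route `LiTailLaguerre`** (stmt-RiemannHypothesis-19704; RH-FREE): for every `c > 0` there
are `N`, `C` with `|liGammaTail n T − liSmoothTail n T| ≤ C log n` whenever `n ≥ N` and `c√n ≤ T ≤ n` — the Cauchy stub and
the connector stub composed as in the registered `LiGammaTailShift_of_stubs`. -/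
theorem liGammaTailShift_bound :
    ∀ c : ℝ, 0 < c → ∃ N : ℕ, ∃ C : ℝ, ∀ n : ℕ, N ≤ n → ∀ T : ℝ, c * Real.sqrt n ≤ T → T ≤ n →
      |liGammaTail n T - liSmoothTail n T| ≤ C * Real.log n := by
  intro c hc
  obtain ⟨N, C, h⟩ := gammaConnector_bound c hc
  obtain ⟨N₀, hN₀⟩ := exists_nat_gt ((1 + 1 / c) ^ 2)
  refine ⟨max N N₀, 1 / Real.pi * C, fun n hn T hT1 hT2 ↦ ?_⟩
  have hN : N ≤ n := le_trans (le_max_left _ _) hn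
  have hnN₀ : (N₀ : ℝ) ≤ n := by exact_mod_cast (le_trans (le_max_right _ _) hn)
  have hc1 : 0 < 1 / c := one_div_pos.mpr hc
  have hs : 1 / c ≤ Real.sqrt n := by
    rw [← Real.sqrt_sq hc1.le]
    exact Real.sqrt_le_sqrt (by nlinarith)
  have hT : 1 ≤ T := by
    have := mul_le_mul_of_nonneg_left hs hc.le
    rw [mul_one_div_cancel hc.ne'] at this
    linarith
  calc |liGammaTail n T - liSmoothTail n T| ≤ 1 / Real.pi * ‖gammaConnector n T‖ :=
        abs_liGammaTail_sub_liSmoothTail_le n hT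
    _ ≤ 1 / Real.pi * (C * Real.log n) :=
        mul_le_mul_of_nonneg_left (h n hN T hT1 hT2) (le_of_lt (by positivity))
    _ = 1 / Real.pi * C * Real.log n := by ring

/-- **Item `LiGammaTailShift` of route `LiTailLaguerre`** (stmt-RiemannHypothesis-19704), closed BY NAME. -/
theorem liGammaTailShift_proof : Summit.RiemannHypothesis.RiemannHypothesis.Theses.LiTailLaguerre.LiGammaTailShift :=
  liGammaTailShift_bound

end Summit.RiemannHypothesis.RiemannHypothesis.Theorems.LiTheory

end
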